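import Literature.AlgebraicGeometry.HodgeTheory.BettiUniverseKunnethHodgePowersNormalForm
import HarnessLib

/-!
# Cup chains: reordering signs, pair regrouping, and the re-summation of matching insertions

Family `hodge`, layer `Literature/AlgebraicGeometry/HodgeTheory`, namespace `BettiUniverse` (the light
Betti–Hodge universe of `BettiUniverseAxioms`). Written for stub A (`stub_matchingClassesAlgebraic`) of the
crux `PowersHodgeOfSignCommutators` (stmt-HodgeConjecture-19717, K2-B line `kunneth-tensor-fft`, route
`HodgeConjecture/SignSymmetricPowers`) and its twin on `HodgeConjecture/CyclicUnitaryPowers`; sequel of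
`BettiUniverseKunnethHodgePowersNormalForm` (the routes' Künneth normal form: classes
`wdec ∪ π_{u 0}^* b_{w 0} ∪ ⋯ ∪ π_{u (r−1)}^* b_{w (r−1)}`, a LEFT-NESTED cup chain recorded as a point of
`Σ i, Hⁱ(Y; ℚ)` by a `List.foldl`). Theorems only; no definition, no named fact (D-0026).

The stubs A ask that the insertion of a MATCHING TENSOR — the contraction
`Σ_w (∏ₘ Θₘ[w(e⁻¹(0,m)), w(e⁻¹(1,m))]) · x(w)` of the chains `x(w)` against matrices `Θₘ` along a pairing
`e : Fin r ≃ Fin 2 × Fin j` of the slots — has algebraic complexification. This file reduces that to the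
two-slot statement "`Σ Θₘ[i,i'] f^* bᵢ ∪ g^* b_{i'}` is algebraic for all `f, g : Y ⟶ X`" (which the routes
get from the Künneth component of the diagonal, `DiagonalKunnethComponentCasimir`, and Fulton's pull-back
fact):

* §1–§2 the cup chain of a list of degree-`n` classes: scalars pass through (`foldl_cupList_smul`), degree
  (`foldl_cupList_fst`), an adjacent transposition of the classes multiplies the chain by `(−1)^{n·n}`
  (`foldl_cupList_ofFn_swap`), hence any permutation by a sign `ε = ±1` depending only on the permutation
  (`foldl_cupList_ofFn_perm`; adjacent transpositions generate, `Equiv.Perm.mclosure_swap_castSucc_succ`);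
* §3 a chain sorted pair by pair is the chain, in steps of degree `2n`, of the pair products
  (`foldl_cupList_flatten_pairs`), and an even class moves freely along such a chain
  (`foldl_cupList_even_comm`);
* §4 sigma bookkeeping for scalar multiples and sums;
* §5 **`ofRatClass_sum_smul_pairChain_mem_algebraicClasses`**: contracting a chain of pairs against the
  `Θₘ` gives `wdec ∪ D₀ ∪ ⋯ ∪ D_{j−1}`, algebraic (induction on `j`, peeling the last pair; multilinearity;
  `ofRatClass_bettiCup_mem_algebraicClasses`);
* §6 **`ofRatClass_sum_smul_cupChain_mem_algebraicClasses`**: the general slot order is sorted by the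
  permutation `e⁻¹ ∘ (m, c ↦ (c, m)) ∘ finProdFinEquiv⁻¹` at the cost of a global sign, the assignments
  `w` are re-indexed by `ω(m) = (w(e⁻¹(0,m)), w(e⁻¹(1,m)))`, and §5 applies.

## References

* A. Hatcher, *Algebraic Topology* (2002), §3.2 Prop. 3.10, Thm. 3.11, p. 211. [HatcherAT2002]
* C. Voisin, *Hodge Theory and Complex Algebraic Geometry II* (2003), proof of Prop. 9.20, Prop. 9.21 (i)
  (cup products and pull-backs of algebraic classes). [VoisinHodgeII2003]
* W. Fulton, *Intersection Theory* (1998), §19.2 Cor. 19.2 (b). [Fulton1998]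
-/

noncomputable section

open Literature.AlgebraicGeometry.Motives
open Literature.AlgebraicTopology.SingularHomology
open CategoryTheory CategoryTheory.Limits

namespace Literature.AlgebraicGeometry.HodgeTheory

namespace BettiUniverse

variable {X Y : SchemeOver ℂ} {n : ℕ}

/-! ## §1 The cup chain of a list of classes: linearity in the initial class, degree -/

/-- **Scalars pass through a cup chain**: folding `acc ↦ acc ∪ y` over a list of classes, starting from
`c • x`, gives `c •` the chain started from `x`. [cite: HatcherAT2002, §3.2 Prop. 3.10 (bilinearity of cup product)] -/
theorem foldl_cupList_smul (l : List (bettiCohomology Y n)) (d : ℕ) (c : ℚ) (x : bettiCohomology Y d) :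
    List.foldl (fun (acc : Σ i, bettiCohomology Y i) (y : bettiCohomology Y n) =>
        ⟨acc.1 + n, cup Y acc.1 n acc.2 y⟩) ⟨d, c • x⟩ l =
      ⟨(List.foldl (fun (acc : Σ i, bettiCohomology Y i) (y : bettiCohomology Y n) =>
          ⟨acc.1 + n, cup Y acc.1 n acc.2 y⟩) ⟨d, x⟩ l).1,
        c • (List.foldl (fun (acc : Σ i, bettiCohomology Y i) (y : bettiCohomology Y n) =>
          ⟨acc.1 + n, cup Y acc.1 n acc.2 y⟩) ⟨d, x⟩ l).2⟩ := by
  induction l generalizing d x with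
  | nil => rfl
  | cons y l ih =>
    rw [List.foldl_cons, List.foldl_cons]
    have h : (⟨d + n, cup Y d n (c • x) y⟩ : Σ i, bettiCohomology Y i) = ⟨d + n, c • cup Y d n x y⟩ := by
      rw [LinearMap.map_smul₂]
    rw [h, ih]

/-- The degree of a cup chain: `d + n · (length of the list)`. [cite: HatcherAT2002, §3.2 Prop. 3.10] -/
theorem foldl_cupList_fst (l : List (bettiCohomology Y n)) (init : Σ i, bettiCohomology Y i) :
    (List.foldl (fun (acc : Σ i, bettiCohomology Y i) (y : bettiCohomology Y n) =>
        ⟨acc.1 + n, cup Y acc.1 n acc.2 y⟩) init l).1 = init.1 + n * l.length := by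
  induction l generalizing init with
  | nil => simp
  | cons y l ih => rw [List.foldl_cons, ih]; simp only [List.length_cons]; ring

/-! ## §2 Reordering the classes of a cup chain costs a sign -/

/-- **Swapping two adjacent classes of a cup chain multiplies it by `(−1)^{n·n}`**
(`(c ∪ y₁) ∪ y₀ = (−1)^{n·n} (c ∪ y₀) ∪ y₁`: associativity and graded commutativity).
[cite: HatcherAT2002, §3.2 Thm. 3.11] -/
theorem foldl_cupList_ofFn_swap (m : ℕ) (i : Fin (m + 1)) (init : Σ i, bettiCohomology Y i)
    (y : Fin (m + 2) → bettiCohomology Y n) :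
    List.foldl (fun (acc : Σ i, bettiCohomology Y i) (y : bettiCohomology Y n) =>
        ⟨acc.1 + n, cup Y acc.1 n acc.2 y⟩) init (List.ofFn (y ∘ Equiv.swap i.castSucc i.succ)) =
      ⟨(List.foldl (fun (acc : Σ i, bettiCohomology Y i) (y : bettiCohomology Y n) =>
          ⟨acc.1 + n, cup Y acc.1 n acc.2 y⟩) init (List.ofFn y)).1,
        ((-1 : ℚ) ^ (n * n)) • (List.foldl (fun (acc : Σ i, bettiCohomology Y i) (y : bettiCohomology Y n) =>
          ⟨acc.1 + n, cup Y acc.1 n acc.2 y⟩) init (List.ofFn y)).2⟩ := by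
  induction m generalizing init with
  | zero =>
    obtain rfl : i = 0 := Fin.eq_zero i
    obtain ⟨d, c⟩ := init
    rw [List.ofFn_succ, List.ofFn_succ, List.ofFn_zero, List.ofFn_succ, List.ofFn_succ, List.ofFn_zero]
    simp only [Function.comp_apply, Fin.castSucc_zero, Fin.succ_zero_eq_one, Equiv.swap_apply_left,
      Fin.succ_zero_eq_one, Equiv.swap_apply_right, List.foldl_cons, List.foldl_nil]
    change (⟨d + n + n, bettiCup rfl (bettiCup rfl c (y 1)) (y 0)⟩ : Σ i, bettiCohomology Y i) =
      ⟨d + n + n, ((-1 : ℚ) ^ (n * n)) • bettiCup rfl (bettiCup rfl c (y 0)) (y 1)⟩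
    rw [bettiCup_assoc rfl rfl rfl (Nat.add_assoc d n n).symm c (y 1) (y 0),
      bettiCup_gradedComm (cupProduct_gradedComm_holds ℚ (ComplexPoints Y)) rfl rfl (y 1) (y 0),
      map_smul, ← bettiCup_assoc rfl rfl rfl (Nat.add_assoc d n n).symm c (y 0) (y 1)]
  | succ m ih =>
    induction i using Fin.cases with
    | zero =>
      obtain ⟨d, c⟩ := init
      rw [List.ofFn_succ, List.ofFn_succ, List.ofFn_succ (f := y), List.ofFn_succ (f := fun i => y i.succ)]
      have h0 : (y ∘ Equiv.swap (0 : Fin (m + 1 + 1)).castSucc (0 : Fin (m + 1 + 1)).succ) 0 = y 1 := by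
        simp
      have h1 : (y ∘ Equiv.swap (0 : Fin (m + 1 + 1)).castSucc (0 : Fin (m + 1 + 1)).succ) (0 : Fin (m+1+1)).succ = y 0 := by
        simp
      have h2 : (fun j : Fin (m + 1) => (y ∘ Equiv.swap (0 : Fin (m + 1 + 1)).castSucc (0 : Fin (m + 1 + 1)).succ)
          j.succ.succ) = fun j => y j.succ.succ := by
        funext j
        simp only [Function.comp_apply, Fin.castSucc_zero, Fin.succ_zero_eq_one]
        rw [Equiv.swap_apply_of_ne_of_ne (Fin.succ_ne_zero _)
          (by rw [← Fin.succ_zero_eq_one]; exact (Fin.succ_injective _).ne (Fin.succ_ne_zero j))]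
      rw [h0, h1, h2]
      simp only [List.foldl_cons]
      have hswap : (⟨d + n + n, cup Y (d + n) n (cup Y d n c (y 1)) (y 0)⟩ : Σ i, bettiCohomology Y i) =
          ⟨d + n + n, ((-1 : ℚ) ^ (n * n)) • cup Y (d + n) n (cup Y d n c (y 0)) (y 1)⟩ := by
        change (⟨d + n + n, bettiCup rfl (bettiCup rfl c (y 1)) (y 0)⟩ : Σ i, bettiCohomology Y i) =
          ⟨d + n + n, ((-1 : ℚ) ^ (n * n)) • bettiCup rfl (bettiCup rfl c (y 0)) (y 1)⟩
        rw [bettiCup_assoc rfl rfl rfl (Nat.add_assoc d n n).symm c (y 1) (y 0),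
          bettiCup_gradedComm (cupProduct_gradedComm_holds ℚ (ComplexPoints Y)) rfl rfl (y 1) (y 0),
          map_smul, ← bettiCup_assoc rfl rfl rfl (Nat.add_assoc d n n).symm c (y 0) (y 1)]
      rw [hswap, foldl_cupList_smul]
      simp only [Fin.succ_zero_eq_one]
      rfl
    | succ i =>
      obtain ⟨d, c⟩ := init
      rw [List.ofFn_succ, List.ofFn_succ (f := y)]
      have h0 : (y ∘ Equiv.swap i.succ.castSucc i.succ.succ) 0 = y 0 := by
        simp only [Function.comp_apply]
        rw [Equiv.swap_apply_of_ne_of_ne]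
        · rw [Fin.castSucc_succ]; exact (Fin.succ_ne_zero _).symm
        · exact (Fin.succ_ne_zero _).symm
      have h1 : (fun j : Fin (m + 2) => (y ∘ Equiv.swap i.succ.castSucc i.succ.succ) j.succ) =
          (fun j : Fin (m + 2) => y j.succ) ∘ Equiv.swap i.castSucc i.succ := by
        funext j
        simp only [Function.comp_apply]
        rw [Fin.castSucc_succ]  -- hmm
        congr 1
        rw [Equiv.swap_apply_def, Equiv.swap_apply_def]
        split_ifs with h₁ h₂ h₃ h₄ <;> simp_all [Fin.succ_inj]
      rw [h0, h1, List.foldl_cons, List.foldl_cons, ih i ⟨d + n, cup Y d n c (y 0)⟩]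


/-- **Permuting the classes of a cup chain multiplies it by a sign `ε = ±1` depending only on the
permutation** (adjacent transpositions generate the symmetric group, `Equiv.Perm.mclosure_swap_castSucc_succ`).
[cite: HatcherAT2002, §3.2 Thm. 3.11] -/
theorem foldl_cupList_ofFn_perm (r : ℕ) (s : Equiv.Perm (Fin r)) :
    ∃ ε : ℚ, (ε = 1 ∨ ε = -1) ∧ ∀ (init : Σ i, bettiCohomology Y i) (y : Fin r → bettiCohomology Y n),
      List.foldl (fun (acc : Σ i, bettiCohomology Y i) (y : bettiCohomology Y n) =>
          ⟨acc.1 + n, cup Y acc.1 n acc.2 y⟩) init (List.ofFn (y ∘ s)) =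
        ⟨(List.foldl (fun (acc : Σ i, bettiCohomology Y i) (y : bettiCohomology Y n) =>
            ⟨acc.1 + n, cup Y acc.1 n acc.2 y⟩) init (List.ofFn y)).1,
          ε • (List.foldl (fun (acc : Σ i, bettiCohomology Y i) (y : bettiCohomology Y n) =>
            ⟨acc.1 + n, cup Y acc.1 n acc.2 y⟩) init (List.ofFn y)).2⟩ := by
  -- trivial identity case, used for `r < 2`
  have hone : ∀ (init : Σ i, bettiCohomology Y i) (y : Fin r → bettiCohomology Y n),
      List.foldl (fun (acc : Σ i, bettiCohomology Y i) (y : bettiCohomology Y n) =>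
          ⟨acc.1 + n, cup Y acc.1 n acc.2 y⟩) init (List.ofFn (y ∘ (1 : Equiv.Perm (Fin r)))) =
        ⟨(List.foldl (fun (acc : Σ i, bettiCohomology Y i) (y : bettiCohomology Y n) =>
            ⟨acc.1 + n, cup Y acc.1 n acc.2 y⟩) init (List.ofFn y)).1,
          (1 : ℚ) • (List.foldl (fun (acc : Σ i, bettiCohomology Y i) (y : bettiCohomology Y n) =>
            ⟨acc.1 + n, cup Y acc.1 n acc.2 y⟩) init (List.ofFn y)).2⟩ := by
    intro init y
    rw [one_smul, Equiv.Perm.coe_one, Function.comp_id]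
  rcases r with _ | _ | m
  · exact ⟨1, Or.inl rfl, fun init y ↦ by rw [Subsingleton.elim s 1]; exact hone init y⟩
  · have h1 : s = 1 := Equiv.ext fun i ↦ Subsingleton.elim (α := Fin 1) _ _
    exact ⟨1, Or.inl rfl, fun init y ↦ by rw [h1]; exact hone init y⟩
  · have hs : s ∈ Submonoid.closure (Set.range fun i : Fin (m + 1) ↦ Equiv.swap i.castSucc i.succ) := by
      rw [Equiv.Perm.mclosure_swap_castSucc_succ]; exact Submonoid.mem_top s
    induction hs using Submonoid.closure_induction with
    | mem t ht =>
      obtain ⟨i, rfl⟩ := ht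
      exact ⟨(-1 : ℚ) ^ (n * n), neg_one_pow_eq_or ℚ (n * n), fun init y ↦ foldl_cupList_ofFn_swap m i init y⟩
    | one => exact ⟨1, Or.inl rfl, hone⟩
    | mul t t' _ _ iht iht' =>
      obtain ⟨ε, hε, h⟩ := iht
      obtain ⟨ε', hε', h'⟩ := iht'
      refine ⟨ε' * ε, ?_, fun init y ↦ ?_⟩
      · rcases hε with rfl | rfl <;> rcases hε' with rfl | rfl <;> norm_num
      · rw [Equiv.Perm.coe_mul, ← Function.comp_assoc, h' init (y ∘ t), h init y, smul_smul]

/-! ## §3 Regrouping a sorted cup chain into a chain of pairs -/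

/-- **Regrouping adjacent pairs**: the cup chain of the concatenated list `[a₀, b₀, a₁, b₁, …]` is the
chain, in steps of degree `2n`, of the pair products `aₘ ∪ bₘ` (associativity). [cite: HatcherAT2002, §3.2 p. 211] -/
theorem foldl_cupList_flatten_pairs (h2 : n + n = 2 * n) (j : ℕ) (init : Σ i, bettiCohomology Y i)
    (a b : Fin j → bettiCohomology Y n) :
    List.foldl (fun (acc : Σ i, bettiCohomology Y i) (y : bettiCohomology Y n) =>
        ⟨acc.1 + n, cup Y acc.1 n acc.2 y⟩) init (List.ofFn fun m ↦ [a m, b m]).flatten =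
      List.foldl (fun (acc : Σ i, bettiCohomology Y i) (P : bettiCohomology Y (2 * n)) =>
        ⟨acc.1 + 2 * n, cup Y acc.1 (2 * n) acc.2 P⟩) init (List.ofFn fun m ↦ bettiCup h2 (a m) (b m)) := by
  induction j generalizing init with
  | zero => simp
  | succ j ih =>
    obtain ⟨d, c⟩ := init
    rw [List.ofFn_succ, List.ofFn_succ (f := fun m ↦ bettiCup h2 (a m) (b m)), List.flatten_cons,
      List.foldl_append, List.foldl_cons, List.foldl_cons, List.foldl_nil, List.foldl_cons, ← ih]
    congr 1
    change (⟨d + n + n, bettiCup rfl (bettiCup rfl c (a 0)) (b 0)⟩ : Σ i, bettiCohomology Y i) =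
      ⟨d + 2 * n, bettiCup rfl c (bettiCup h2 (a 0) (b 0))⟩
    rw [bettiCup_assoc rfl h2 rfl (by omega) c (a 0) (b 0)]
    exact sigma_mk_bettiCup_eq _ _ c _

/-- **An even class moves freely along a chain of even classes**: starting the pair chain from `c ∪ D`
(`D` of degree `2n`) is the same as ending it with `∪ D`. [cite: HatcherAT2002, §3.2 Thm. 3.11] -/
theorem foldl_cupList_even_comm (l : List (bettiCohomology Y (2 * n))) (d : ℕ) (c : bettiCohomology Y d)
    (D : bettiCohomology Y (2 * n)) :
    List.foldl (fun (acc : Σ i, bettiCohomology Y i) (P : bettiCohomology Y (2 * n)) =>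
        ⟨acc.1 + 2 * n, cup Y acc.1 (2 * n) acc.2 P⟩) ⟨d + 2 * n, cup Y d (2 * n) c D⟩ l =
      ⟨(List.foldl (fun (acc : Σ i, bettiCohomology Y i) (P : bettiCohomology Y (2 * n)) =>
          ⟨acc.1 + 2 * n, cup Y acc.1 (2 * n) acc.2 P⟩) ⟨d, c⟩ l).1 + 2 * n,
        cup Y _ (2 * n) (List.foldl (fun (acc : Σ i, bettiCohomology Y i) (P : bettiCohomology Y (2 * n)) =>
          ⟨acc.1 + 2 * n, cup Y acc.1 (2 * n) acc.2 P⟩) ⟨d, c⟩ l).2 D⟩ := by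
  induction l generalizing d c with
  | nil => rfl
  | cons P l ih =>
    rw [List.foldl_cons, List.foldl_cons]
    have hstep : (⟨d + 2 * n + 2 * n, cup Y (d + 2 * n) (2 * n) (cup Y d (2 * n) c D) P⟩ :
        Σ i, bettiCohomology Y i) = ⟨d + 2 * n + 2 * n, cup Y (d + 2 * n) (2 * n) (cup Y d (2 * n) c P) D⟩ := by
      change (⟨d + 2 * n + 2 * n, bettiCup rfl (bettiCup rfl c D) P⟩ : Σ i, bettiCohomology Y i) =
        ⟨d + 2 * n + 2 * n, bettiCup rfl (bettiCup rfl c P) D⟩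
      rw [bettiCup_assoc rfl rfl rfl (Nat.add_assoc _ _ _).symm c D P,
        bettiCup_gradedComm (cupProduct_gradedComm_holds ℚ (ComplexPoints Y)) rfl rfl D P,
        show ((-1 : ℚ) ^ (2 * n * (2 * n))) = 1 from Even.neg_one_pow ⟨n * (2 * n), by ring⟩, one_smul,
        ← bettiCup_assoc rfl rfl rfl (Nat.add_assoc _ _ _).symm c P D]
    rw [hstep, ih]

/-! ## §4 Sigma bookkeeping for sums -/

/-- Reading a scalar multiple in the degree given by a sigma equation. [cite: HatcherAT2002, §3.2 Prop. 3.10] -/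
theorem sigma_mk_smul_eq_of_eq {M : ℕ} (v : bettiCohomology Y M) (S : Σ i, bettiCohomology Y i)
    (h : (⟨M, v⟩ : Σ i, bettiCohomology Y i) = S) (c : ℚ) :
    (⟨M, c • v⟩ : Σ i, bettiCohomology Y i) = ⟨S.1, c • S.2⟩ := by
  subst h; rfl

/-- Summing sigma equations with a common degree. [cite: HatcherAT2002, §3.2 Prop. 3.10] -/
theorem sigma_mk_sum_smul_eq {M d : ℕ} {T : Type*} [Fintype T] (x : T → bettiCohomology Y M)
    (g : T → bettiCohomology Y d) (a : T → ℚ) (hMd : M = d)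
    (h : ∀ t, (⟨M, x t⟩ : Σ i, bettiCohomology Y i) = ⟨d, g t⟩) :
    (⟨M, ∑ t, a t • x t⟩ : Σ i, bettiCohomology Y i) = ⟨d, ∑ t, a t • g t⟩ := by
  subst hMd
  have hx : ∀ t, x t = g t := fun t ↦ eq_of_heq (Sigma.mk.inj_iff.1 (h t)).2
  simp only [hx]


/-! ## §5 Re-summation of a contracted pair chain: algebraicity -/

/-- **Contracting a chain of pairs against matrices gives an algebraic class.** On a smooth projective `Y`
let `wdec ∈ H^{2q}(Y; ℚ)` have algebraic complexification, let `Aₘ, Bₘ : Y ⟶ X` (`m < j`) be maps, `b` a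
family in `Hⁿ(X; ℚ)` and `Θₘ` matrices such that each `Dₘ = Σ_{i,i'} Θₘ[i,i'] · Aₘ^*bᵢ ∪ Bₘ^*b_{i'}` has
algebraic complexification. If `x(ω) ∈ H^{2p}(Y; ℚ)` (`ω : Fin j → ι × ι`) is the pair chain
`wdec ∪ (A₀^*b_{ω₀.1} ∪ B₀^*b_{ω₀.2}) ∪ ⋯` (a sigma equation, as in the routes' normal forms), then
`Σ_ω (∏ₘ Θₘ[ωₘ]) · x(ω) = wdec ∪ D₀ ∪ ⋯ ∪ D_{j−1}` has algebraic complexification (multilinearity; cup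
products and pull-backs preserve algebraic classes, granted Fulton's pull-back fact `hP`).
[cite: VoisinHodgeII2003, proof of Prop. 9.20 and Prop. 9.21 (i)] [cite: Fulton1998, §19.2 Cor. 19.2 (b)] -/
theorem ofRatClass_sum_smul_pairChain_mem_algebraicClasses (hP : fulton1998_map_mem_algebraicClasses)
    {l : ℕ} (hY : IsSmoothProjective l Y) (h2 : n + n = 2 * n) {ι : Type*} [Fintype ι] [DecidableEq ι]
    (bX : ι → bettiCohomology X n) (j : ℕ) :
    ∀ (A B : Fin j → (Y ⟶ X)) (Θ : Fin j → ι → ι → ℚ)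
      (_hΘ : ∀ m, ofRatClass (ComplexPoints Y) (2 * n)
        (∑ i, ∑ i', Θ m i i' • bettiCup h2 (pull (A m) n (bX i)) (pull (B m) n (bX i'))) ∈ algebraicClasses Y n)
      (q : ℕ) (wdec : bettiCohomology Y (2 * q))
      (_hwdec : ofRatClass (ComplexPoints Y) (2 * q) wdec ∈ algebraicClasses Y q)
      (p : ℕ) (x : (Fin j → ι × ι) → bettiCohomology Y (2 * p))
      (_hx : ∀ ω, (⟨2 * p, x ω⟩ : Σ i, bettiCohomology Y i) =
        List.foldl (fun (acc : Σ i, bettiCohomology Y i) (P : bettiCohomology Y (2 * n)) =>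
            ⟨acc.1 + 2 * n, cup Y acc.1 (2 * n) acc.2 P⟩) ⟨2 * q, wdec⟩
          (List.ofFn fun m ↦ bettiCup h2 (pull (A m) n (bX (ω m).1)) (pull (B m) n (bX (ω m).2)))),
      ofRatClass (ComplexPoints Y) (2 * p) (∑ ω, (∏ m, Θ m (ω m).1 (ω m).2) • x ω) ∈ algebraicClasses Y p := by
  induction j with
  | zero =>
    intro A B Θ hΘ q wdec hwdec p x hx
    have h0 := hx default
    rw [List.ofFn_zero, List.foldl_nil] at h0
    obtain ⟨hpq, hxw⟩ := Sigma.mk.inj_iff.1 h0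
    obtain rfl : p = q := by omega
    have hxw' : x default = wdec := eq_of_heq hxw
    rw [Fintype.sum_unique, Finset.univ_eq_empty, Finset.prod_empty, one_smul, hxw']
    exact hwdec
  | succ j ih =>
    intro A B Θ hΘ q wdec hwdec p x hx
    rcases isEmpty_or_nonempty ι with hι | hι
    · haveI : IsEmpty (Fin (j + 1) → ι × ι) := by
        refine ⟨fun ω ↦ ?_⟩
        exact hι.elim (ω 0).1
      rw [Fintype.sum_empty, map_zero]
      exact Submodule.zero_mem _
    -- notation for the last pair
    set D : bettiCohomology Y (2 * n) := ∑ i, ∑ i', Θ (Fin.last j) i i' •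
      bettiCup h2 (pull (A (Fin.last j)) n (bX i)) (pull (B (Fin.last j)) n (bX i')) with hD
    set Pl : ι × ι → bettiCohomology Y (2 * n) := fun pr ↦
      bettiCup h2 (pull (A (Fin.last j)) n (bX pr.1)) (pull (B (Fin.last j)) n (bX pr.2)) with hPl
    have hDsum : D = ∑ pr : ι × ι, Θ (Fin.last j) pr.1 pr.2 • Pl pr := by
      rw [hD, Fintype.sum_prod_type]
    -- the chain over the first `j` pairs
    set prev : (Fin j → ι × ι) → Σ i, bettiCohomology Y i := fun ω' ↦
      List.foldl (fun (acc : Σ i, bettiCohomology Y i) (P : bettiCohomology Y (2 * n)) =>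
          ⟨acc.1 + 2 * n, cup Y acc.1 (2 * n) acc.2 P⟩) ⟨2 * q, wdec⟩
        (List.ofFn fun m : Fin j ↦ bettiCup h2 (pull (A m.castSucc) n (bX (ω' m).1))
          (pull (B m.castSucc) n (bX (ω' m).2))) with hprev
    have hsplit : ∀ (ω' : Fin j → ι × ι) (pr : ι × ι),
        (⟨2 * p, x (Fin.snoc ω' pr)⟩ : Σ i, bettiCohomology Y i) =
          ⟨(prev ω').1 + 2 * n, cup Y _ (2 * n) (prev ω').2 (Pl pr)⟩ := by
      intro ω' pr
      rw [hx, List.ofFn_succ', List.concat_eq_append, List.foldl_append, List.foldl_cons, List.foldl_nil]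
      have hcs : ∀ i : Fin j, (Fin.snoc ω' pr : Fin (j + 1) → ι × ι) i.castSucc = ω' i :=
        fun i ↦ Fin.snoc_castSucc (α := fun _ ↦ ι × ι) (x := pr) (p := ω') (i := i)
      have hl : (Fin.snoc ω' pr : Fin (j + 1) → ι × ι) (Fin.last j) = pr :=
        Fin.snoc_last (α := fun _ ↦ ι × ι) (x := pr) (p := ω')
      have hfun : (fun i : Fin j ↦ bettiCup h2 (pull (A i.castSucc) n
            (bX ((Fin.snoc ω' pr : Fin (j + 1) → ι × ι) i.castSucc).1))
          (pull (B i.castSucc) n (bX ((Fin.snoc ω' pr : Fin (j + 1) → ι × ι) i.castSucc).2))) =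
          fun m ↦ bettiCup h2 (pull (A m.castSucc) n (bX (ω' m).1)) (pull (B m.castSucc) n (bX (ω' m).2)) := by
        funext i; rw [hcs]
      rw [hfun]
      simp only [hl, hPl]
      rfl
    -- degrees
    have hdeg : ∀ ω' : Fin j → ι × ι, (prev ω').1 = 2 * q + 2 * n * j := by
      intro ω'
      rw [hprev, foldl_cupList_fst, List.length_ofFn]
    obtain ⟨i₀⟩ := hι
    have hpd : 2 * p = 2 * q + 2 * n * j + 2 * n := by
      have h := congrArg Sigma.fst (hsplit (fun _ ↦ (i₀, i₀)) (i₀, i₀))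
      dsimp only at h
      rw [hdeg] at h
      exact h
    -- the contracted last pair
    set x' : (Fin j → ι × ι) → bettiCohomology Y (2 * p) := fun ω' ↦
      ∑ pr : ι × ι, Θ (Fin.last j) pr.1 pr.2 • x (Fin.snoc ω' pr) with hx'
    have hq : 2 * q + 2 * n = 2 * (q + n) := by ring
    have hx'chain : ∀ ω', (⟨2 * p, x' ω'⟩ : Σ i, bettiCohomology Y i) =
        List.foldl (fun (acc : Σ i, bettiCohomology Y i) (P : bettiCohomology Y (2 * n)) =>
            ⟨acc.1 + 2 * n, cup Y acc.1 (2 * n) acc.2 P⟩) ⟨2 * (q + n), bettiCup hq wdec D⟩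
          (List.ofFn fun m : Fin j ↦ bettiCup h2 (pull ((A ∘ Fin.castSucc) m) n (bX (ω' m).1))
            (pull ((B ∘ Fin.castSucc) m) n (bX (ω' m).2))) := by
      intro ω'
      have h1 : (⟨2 * p, x' ω'⟩ : Σ i, bettiCohomology Y i) =
          ⟨(prev ω').1 + 2 * n, ∑ pr : ι × ι, Θ (Fin.last j) pr.1 pr.2 • cup Y _ (2 * n) (prev ω').2 (Pl pr)⟩ :=
        sigma_mk_sum_smul_eq _ _ _ (by rw [hpd, hdeg]) (hsplit ω')
      have h2' : ∑ pr : ι × ι, Θ (Fin.last j) pr.1 pr.2 • cup Y _ (2 * n) (prev ω').2 (Pl pr) =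
          cup Y _ (2 * n) (prev ω').2 D := by
        rw [hDsum, map_sum]
        simp only [map_smul]
      rw [h1, h2', ← foldl_cupList_even_comm]
      have hinit : (⟨2 * q + 2 * n, cup Y (2 * q) (2 * n) wdec D⟩ : Σ i, bettiCohomology Y i) =
          ⟨2 * (q + n), bettiCup hq wdec D⟩ := sigma_mk_bettiCup_eq _ _ _ _
      rw [hinit]
      rfl
    -- induction hypothesis
    have hIH := ih (A ∘ Fin.castSucc) (B ∘ Fin.castSucc) (Θ ∘ Fin.castSucc) (fun m ↦ hΘ m.castSucc) (q + n)
      (bettiCup hq wdec D) (ofRatClass_bettiCup_mem_algebraicClasses hP hY hq hwdec (hΘ (Fin.last j))) p x' hx'chain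
    -- re-indexing the sum
    have hsum : ∑ ω, (∏ m, Θ m (ω m).1 (ω m).2) • x ω =
        ∑ ω' : Fin j → ι × ι, (∏ m, (Θ ∘ Fin.castSucc) m (ω' m).1 (ω' m).2) • x' ω' := by
      rw [← (Fin.snocEquiv fun _ ↦ ι × ι).sum_comp, Fintype.sum_prod_type, Finset.sum_comm]
      refine Finset.sum_congr rfl fun ω' _ ↦ ?_
      rw [hx', Finset.smul_sum]
      refine Finset.sum_congr rfl fun pr _ ↦ ?_
      rw [smul_smul, Fin.prod_univ_castSucc]
      have hsE : (Fin.snocEquiv fun _ ↦ ι × ι) (pr, ω') = Fin.snoc ω' pr := rfl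
      have hcs : ∀ i : Fin j, (Fin.snoc ω' pr : Fin (j + 1) → ι × ι) i.castSucc = ω' i :=
        fun i ↦ Fin.snoc_castSucc (α := fun _ ↦ ι × ι) (x := pr) (p := ω') (i := i)
      have hl : (Fin.snoc ω' pr : Fin (j + 1) → ι × ι) (Fin.last j) = pr :=
        Fin.snoc_last (α := fun _ ↦ ι × ι) (x := pr) (p := ω')
      rw [hsE]
      simp only [hcs, hl, Function.comp_apply]
    rw [hsum]
    exact hIH


/-! ## §6 The insertion of a matching tensor is algebraic -/

/-- **Re-summation of a matching insertion.** Let `x(w) ∈ H^{2p}(Y; ℚ)`, `w : Fin r → ι`, be the classes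
`wdec ∪ π_{u 0}^* b_{w 0} ∪ ⋯ ∪ π_{u (r−1)}^* b_{w (r−1)}` (left-nested, a sigma equation — the routes'
Künneth normal form), `e : Fin r ≃ Fin 2 × Fin j` a pairing of the slots and `Θₘ` matrices whose
two-slot insertions `Σ Θₘ[i,i'] f^*bᵢ ∪ g^*b_{i'}` have algebraic complexification for all `f, g : Y ⟶ X`.
Then the contraction `Σ_w (∏ₘ Θₘ[w(e⁻¹(0,m)), w(e⁻¹(1,m))]) · x(w)` has algebraic complexification:
sorting the slots pair by pair costs a global sign (`foldl_cupList_ofFn_perm`), the sorted chain is a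
chain of pairs (`foldl_cupList_flatten_pairs`), and the pair chain contracts to `± wdec ∪ D₀ ∪ ⋯`
(`ofRatClass_sum_smul_pairChain_mem_algebraicClasses`). This is the geometric half ("Künneth components
of graph classes, cup and pull-back closure") of the algebraicity of matching-tensor insertions.
[cite: VoisinHodgeII2003, proof of Prop. 9.20 and Prop. 9.21 (i)] [cite: Fulton1998, §19.2 Cor. 19.2 (b)]
[cite: HatcherAT2002, §3.2 Thm. 3.11] -/
theorem ofRatClass_sum_smul_cupChain_mem_algebraicClasses (hP : fulton1998_map_mem_algebraicClasses)
    {l : ℕ} (hY : IsSmoothProjective l Y) (h2 : n + n = 2 * n) {ι : Type*} [Fintype ι] [DecidableEq ι]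
    (bX : ι → bettiCohomology X n) {m : ℕ} (π : Fin (m + 1) → (Y ⟶ X)) {r : ℕ} (u : Fin r → Fin (m + 1))
    (q : ℕ) (wdec : bettiCohomology Y (2 * q))
    (hwdec : ofRatClass (ComplexPoints Y) (2 * q) wdec ∈ algebraicClasses Y q)
    (p : ℕ) (x : (Fin r → ι) → bettiCohomology Y (2 * p))
    (hx : ∀ w, (⟨2 * p, x w⟩ : Σ i, bettiCohomology Y i) =
      List.foldl (fun (acc : Σ i, bettiCohomology Y i) (i : Fin r) =>
          ⟨acc.1 + n, cup Y acc.1 n acc.2 (pull (π (u i)) n (bX (w i)))⟩) ⟨2 * q, wdec⟩ (List.finRange r))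
    {j : ℕ} (e : Fin r ≃ Fin 2 × Fin j) (Θ : Fin j → ι → ι → ℚ)
    (hΘ : ∀ (mm : Fin j) (f g : Y ⟶ X), ofRatClass (ComplexPoints Y) (2 * n)
      (∑ i, ∑ i', Θ mm i i' • bettiCup h2 (pull f n (bX i)) (pull g n (bX i'))) ∈ algebraicClasses Y n) :
    ofRatClass (ComplexPoints Y) (2 * p)
      (∑ w : Fin r → ι, (∏ mm, Θ mm (w (e.symm (0, mm))) (w (e.symm (1, mm)))) • x w) ∈
      algebraicClasses Y p := by
  -- `r = 2j`
  have hr : r = j * 2 := by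
    have hc := Fintype.card_congr e
    simp only [Fintype.card_fin, Fintype.card_prod] at hc
    omega
  subst hr
  -- the sorting permutation
  set s : Equiv.Perm (Fin (j * 2)) :=
    finProdFinEquiv.symm.trans ((Equiv.prodComm (Fin j) (Fin 2)).trans e.symm) with hsdef
  have hs : ∀ (mm : Fin j) (c : Fin 2), s (finProdFinEquiv (mm, c)) = e.symm (c, mm) := by
    intro mm c
    simp [hsdef]
  obtain ⟨ε, hε, hperm⟩ := foldl_cupList_ofFn_perm (Y := Y) (n := n) (j * 2) s
  have hεsq : ε * ε = 1 := by rcases hε with rfl | rfl <;> norm_num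
  -- the chain of `w` as a fold over the list of its classes
  have hchain : ∀ w : Fin (j * 2) → ι,
      List.foldl (fun (acc : Σ i, bettiCohomology Y i) (y : bettiCohomology Y n) =>
          ⟨acc.1 + n, cup Y acc.1 n acc.2 y⟩) ⟨2 * q, wdec⟩
        (List.ofFn fun i ↦ pull (π (u i)) n (bX (w i))) =
      List.foldl (fun (acc : Σ i, bettiCohomology Y i) (i : Fin (j * 2)) =>
          ⟨acc.1 + n, cup Y acc.1 n acc.2 (pull (π (u i)) n (bX (w i)))⟩) ⟨2 * q, wdec⟩ (List.finRange (j * 2)) := by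
    intro w
    rw [List.ofFn_eq_map, List.foldl_map]
  -- the sorted list of classes is the concatenation of the pairs
  have hsorted : ∀ w : Fin (j * 2) → ι,
      List.ofFn ((fun i ↦ pull (π (u i)) n (bX (w i))) ∘ s) =
        (List.ofFn fun mm : Fin j ↦ [pull (π (u (e.symm (0, mm)))) n (bX (w (e.symm (0, mm)))),
          pull (π (u (e.symm (1, mm)))) n (bX (w (e.symm (1, mm))))]).flatten := by
    intro w
    rw [List.ofFn_mul]
    congr 1
    refine List.ofFn_inj.2 (funext fun mm ↦ ?_)
    rw [List.ofFn_succ, List.ofFn_succ, List.ofFn_zero]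
    have hs' : ∀ (c : Fin 2) (t : Fin (j * 2)), (t : ℕ) = mm * 2 + c → s t = e.symm (c, mm) := by
      intro c t ht
      have htt : t = finProdFinEquiv (mm, c) := Fin.ext (by change (t : ℕ) = c + 2 * mm; omega)
      rw [htt, hs]
    have key : ∀ t0 t1 : Fin (j * 2), (t0 : ℕ) = mm * 2 + ((0 : Fin 2) : ℕ) →
        (t1 : ℕ) = mm * 2 + ((1 : Fin 2) : ℕ) →
        [((fun i ↦ pull (π (u i)) n (bX (w i))) ∘ s) t0, ((fun i ↦ pull (π (u i)) n (bX (w i))) ∘ s) t1] =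
        [pull (π (u (e.symm (0, mm)))) n (bX (w (e.symm (0, mm)))),
          pull (π (u (e.symm (1, mm)))) n (bX (w (e.symm (1, mm))))] := by
      intro t0 t1 h0 h1
      simp only [Function.comp_apply, hs' 0 t0 h0, hs' 1 t1 h1]
    exact key _ _ rfl rfl
  -- re-indexing of the assignments
  let W : (Fin j → ι × ι) ≃ (Fin (j * 2) → ι) :=
    ⟨fun ω i ↦ ![(ω (e i).2).1, (ω (e i).2).2] (e i).1,
     fun w mm ↦ (w (e.symm (0, mm)), w (e.symm (1, mm))),
     fun ω ↦ funext fun mm ↦ by simp,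
     fun w ↦ funext fun i ↦ by
       have key : ∀ (c : Fin 2) (mm : Fin j), e i = (c, mm) →
           ![w (e.symm (0, mm)), w (e.symm (1, mm))] c = w i := by
         intro c mm h
         have hi : i = e.symm (c, mm) := by rw [← h, Equiv.symm_apply_apply]
         fin_cases c <;> simp [hi]
       exact key (e i).1 (e i).2 rfl⟩
  have hW0 : ∀ ω mm, W ω (e.symm (0, mm)) = (ω mm).1 := fun ω mm ↦ by simp [W]
  have hW1 : ∀ ω mm, W ω (e.symm (1, mm)) = (ω mm).2 := fun ω mm ↦ by simp [W]
  -- the pair chain of the sorted assignment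
  have hx' : ∀ ω : Fin j → ι × ι, (⟨2 * p, ε • x (W ω)⟩ : Σ i, bettiCohomology Y i) =
      List.foldl (fun (acc : Σ i, bettiCohomology Y i) (P : bettiCohomology Y (2 * n)) =>
          ⟨acc.1 + 2 * n, cup Y acc.1 (2 * n) acc.2 P⟩) ⟨2 * q, wdec⟩
        (List.ofFn fun mm ↦ bettiCup h2 (pull (π (u (e.symm (0, mm)))) n (bX (ω mm).1))
          (pull (π (u (e.symm (1, mm)))) n (bX (ω mm).2))) := by
    intro ω
    rw [sigma_mk_smul_eq_of_eq _ _ (hx (W ω)) ε, ← hchain, ← hperm, hsorted,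
      foldl_cupList_flatten_pairs h2]
    simp only [hW0, hW1]
  have hT := ofRatClass_sum_smul_pairChain_mem_algebraicClasses hP hY h2 bX j
    (fun mm ↦ π (u (e.symm (0, mm)))) (fun mm ↦ π (u (e.symm (1, mm)))) Θ (fun mm ↦ hΘ mm _ _)
    q wdec hwdec p (fun ω ↦ ε • x (W ω)) hx'
  -- comparison of the two sums
  have hsum : ∑ w : Fin (j * 2) → ι, (∏ mm, Θ mm (w (e.symm (0, mm))) (w (e.symm (1, mm)))) • x w =
      ε • ∑ ω : Fin j → ι × ι, (∏ mm, Θ mm (ω mm).1 (ω mm).2) • (ε • x (W ω)) := by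
    rw [← W.sum_comp, Finset.smul_sum]
    refine Finset.sum_congr rfl fun ω _ ↦ ?_
    simp only [hW0, hW1, smul_smul]
    congr 1
    rw [← mul_assoc, mul_comm ε, mul_assoc, hεsq, mul_one]
  rw [hsum, ofRatClass_smul]
  exact Submodule.smul_mem _ _ hT

end BettiUniverse

end Literature.AlgebraicGeometry.HodgeTheory

end
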